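import Literature.MathematicalPhysics.QuantumFieldTheory.Balaban1983to89.B4Lemma22ZeroBoxSharp

/-!
# `Balaban1983to89.B4Lemma22ZeroBoxDimOne` — THE ONE-DIMENSIONAL LATTICE: AT ZERO FIELD ON BOXES `□ ⊂ ηℤ¹`,
# B4 LEMMA 2.2 (2.17) HOLDS FOR ALL `1 ≤ p ≤ q ≤ ∞` WITH NO CONDITION ON `1/p − 1/q` (THE KERNELS OF `G_k(□)`,
# `D^η_μ G_k(□)`, `G_k(□)D^{η*}_μ` ARE `O(η)` POINTWISE), SO b04's TYPED `B4.Lemma22Printed (cubeFam ℓ m²₊ a Mb K) d'`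
# HOLDS OVER `ℤ¹` FOR EVERY `d'`; WITH NODE 20: OVER `ℤ^{d+1}` IT HOLDS IFF `d = 0 ∨ d + 1 ≤ d'`

**Source.** T. Bałaban, *Regularity and Decay of Lattice Green's Functions*, Commun. Math. Phys. **89**, 571–597
(1983) (bib key `Balaban1983RegularityDecay`, «B4»): pp. 577–578 [PDF 7–8] Lemma 2.2 with (2.16)–(2.17); p. 572
[PDF 2] the lattice and (1.1); p. 583 [PDF 13] the proof of (2.17) for `G_k(□)` (journal page = PDF page + 570).
Quoted from the page renders `b2b-balaban-ref1/pages/1983-cmp89-regularity-decay/1983-cmp89-regularity-decay-p002-x2.png`,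
`…-p007-x2.png`, `…-p008-x2.png`, `…-p013-x2.png` (not from the OCR text); the print's `≦` is written `≤`.

## WHAT IS PRINTED (verbatim from the renders)

pp. 577–578, Lemma 2.2: «Let a rectangular parallelepiped □ be a sum of few large blocks (e.g., as in the case of
the cubes □_j), and let Ã be a regular vector field configuration in the sense of Proposition I.2.1, constant in a
neighbourhood of the boundary of □. Then for e sufficiently small and α < 1, there exists a constant c₁ depending on
d, α only, such that ‖G_k(□,Ã)f‖_{1,α} ≤ c₁‖f‖_∞, (2.16) and a constant c₂ depending on d, p₁, such that
‖G_k(□,Ã)f‖_q, ‖D^η_{Ã,μ}G_k(□,Ã)f‖_q, ‖G_k(□,Ã)D^{η*}_{Ã,μ}f‖_q ≤ c₂‖f‖_p (2.17) for 1 ≤ p, q ≤ ∞, satisfying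
the condition 1/p − 1/p₁ ≤ 1/q ≤ 1/p with p₁ > d.»

p. 583: «Now we will prove that the operators G_k(□), ∂^η_μG_k(□), G_k(□)∂^{η*}_μ are bounded operators from
L^{p₁}(□) with p₁ > d to L^∞(□). […] ≤ O(1)η^{1−d/p₁}‖f‖_{p₁} + Σ_{j=1}^{k−1} O(1)(L^jη)^{1−d/p₁}‖f‖_{p₁}
≤ c′₂‖f‖_{p₁} (2.41) for x ∈ □, p₁ > d, where the constant c′₂ is built of c₀, Σ_{x∈Z^d} e^{−δ₀|x|},
Σ_{j=1}^∞ (L^{−j})^{1−d/p₁}.»  The print's `d` is the number of dimensions of the lattice: p. 572 [PDF 2] «We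
consider operators on subsets of the lattice ηZ^d, η = L^{−k}.» and (1.1) «B^k(y) = Δ(y) = {x∈ηZ^d : y_μ ≤ x_μ <
y_μ + 1, μ = 1, ..., d}, y∈Z^d.» (render `…-p002-x2.png`); in this package the lattice is `Fin (d+1) → ℤ`, of
dimension `d + 1`, so the print's `d` is this package's `d + 1`, and THIS FILE treats the package's `d = 0`: the
print's `d = 1`, the lattice `ηZ¹`, where the printed condition reads «p₁ > 1».

## WHAT IS CERTIFIED (HONEST SCOPE)

b04's TYPED LEAF `B4.Lemma22Printed (fam : I → CubeSetting) (d' : ℕ)` carries the printed «p₁ > d» as the free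
parameter `d'` (conjunct 2: `∀ p₁ : ℝ, (d' : ℝ) < p₁ → ∃ c₂ e₁ > 0, ∀ i, rect → fewLargeBlocks → regular →
constNearBdry → 0 < e → e ≤ e₁ → ∀ s t n μ f, 0 ≤ t → s ≤ 1 → s − 1/p₁ ≤ t → t ≤ s → ‖Y_n f‖_{1/t} ≤ c₂‖f‖_{1/s}`
in the `η`-weighted norms `ZeroFieldCube.lpN` of (2.11); conjunct 1 is (2.16)).  On the ZERO-FIELD BOX FAMILIES
`cubeFam ℓ m²₊ a Mb K : BoxInst d ℓ m²₊ → CubeSetting` of node 15 (`Ã = 0`; every scale `k ≥ 1`, mesh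
`η = (ℓ+1)^{-k}`, every box `Π_μ[0, M_μ)`, every mass `m² ∈ [0, m²₊]`, every charge; the operator (1.6) with
averaging weight `a > 0`) node 19 proved the leaf at the faithful `d' = d + 1` and node 20 proved that for `d ≥ 1`
it FAILS at every `d' ≤ d`, leaving the package's `d = 0` — the lattice `ηZ¹` — explicitly untreated.  THIS LEAF
SETTLES `d = 0`:

* `lemma22_17_zero_box_dimOne` — THE QUANTITATIVE CORE OVER `ℤ¹`, ALL EXPONENTS: for `ℓ ≥ 1`, `a > 0` ONE
  constant `c₂ > 0` with `‖Y_n f‖_{1/t} ≤ c₂‖f‖_{1/s}` for all three operators `Y_n ∈ {G_k(□), D^η_μG_k(□),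
  G_k(□)D^{η*}_μ}`, every member of the family and ALL `0 ≤ t ≤ s ≤ 1` — i.e. (2.17) for all `1 ≤ p ≤ q ≤ ∞` with
  NO condition `1/p − 1/q ≤ 1/p₁`; in particular all three are bounded `L¹(□) → L^∞(□)` uniformly in `η`.
* `lemma22Printed_cubeFam_dimOne` — hence the typed leaf `Lemma22Printed (cubeFam (d := 0) ℓ m²₊ a Mb K) d'` holds
  for EVERY `d' : ℕ` (conjunct 1 from node 15's `lemma22Printed16_cubeFam`), including the printed threshold
  `d' = 0` (where `p₁ ≤ 1` is admitted and the constraint `s − 1/p₁ ≤ t` is void).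
* `lemma22Printed_cubeFam_iff_all` — THE GLOBAL DICHOTOMY (with node 20's `lemma22Printed_cubeFam_iff`): for every
  `d` and `d'` (`ℓ, Mb, K ≥ 1`, `a > 0`, `m²₊ ≥ 0`), `Lemma22Printed (cubeFam ℓ m²₊ a Mb K) d' ↔ (d = 0 ∨ d + 1 ≤ d')`.
* the mechanism, certified on the way (lattice units, `n = (ℓ+1)^k = η^{-1}` sites per unit length, `A = boxOpR n a
  m² M = n²(−Δ^N_□) + m² + (a/n)·1_{blk · = blk ·}` the operator (1.6), `G = A⁻¹`): `sq_le_energy` — THE POINTWISE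
  ENERGY BOUND `v(x)² ≤ (c⋆/n)⟨v, Av⟩`, `c⋆ = 4 + 2/a`, for every `v` and every site (`n·v(x)` = the block sum of `v`
  + the in-block oscillation; the first is bounded through the averaging term, the second through the `< n` bonds
  of the block and the Dirichlet form, `sq_sub_le_of_blk`; the resulting entry scale `1/n = η = η^{d+1}` is the
  weight of `‖·‖₁` precisely because the lattice is one-dimensional);
  `entry_le` — `|G(x′, x)| ≤ c⋆/n` (the column `G(·, x)` has energy `G(x, x)`); `bond_step`, `bond_energy`,
  `window`, `bond_le` — the forward differences of a column satisfy `|β(z−1) − β(z)| ≤ (m²₊ + a)c⋆/n³` off the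
  source (the site equation) and `Σ_z β(z)² ≤ 2c⋆/n³`, whence `|β(z)| ≤ C_b/n²` for EVERY bond,
  `C_b = 2(m²₊ + a)c⋆ + 1 + 8c⋆` (an `n`-bond window pointing away from the source: either the increments dominate,
  `|β| ≤ 2n·(m²₊+a)c⋆/n³`, or the energy does, `β² ≤ 4·(2c⋆/n³)/n`); `kerY_entry_le` — so all three kernels of
  (2.17) (node 15's `kerY`; `D^η = n·(forward difference)`, the adjoint one by the symmetry of `G`) are bounded by
  `max(1, C_b)/n` entrywise; with node 15's uniform row/column sums `A` node 19's weighted Young inequality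
  `lpN_young` gives the constant `max(1, C_b)^{s−t}·A^{1−(s−t)} ≤ max(1, C_b)·max(1, A)` for `s − t < 1`, and the
  entry bound alone gives `‖Y f‖_∞ ≤ max(1, C_b)‖f‖₁` at `(s, t) = (1, 0)`.

READING (for b04 / the carver).  (i) Over the one-dimensional lattice the printed restriction «p₁ > d» (there:
«p₁ > 1») is not needed in the zero-field box case: the three kernels are `O(η)` pointwise, uniformly in the box,
the scale and the mass.  The print's own route does not give this — its constant `c′₂` in (2.41) contains
`Σ_{j=1}^∞ (L^{−j})^{1−d/p₁}`, finite only for `p₁ > d` — and no published statement is contradicted: the print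
assumes «p₁ > d» throughout.  (ii) Together with nodes 19/20 the typed leaf is now decided on every zero-field cube
family for every value of its parameter: true exactly when `d = 0` or `d' ≥ d + 1`.  b04 instantiates the leaf at
`d' = d + 1` (node 19), which is available in every dimension; the present file only completes the table.
(iii) Nothing here bears on `Ã ≠ 0`, on regions other than boxes, or on Lemma 2.2's role in the paper.

NOT CERTIFIED / NOT CLAIMED: anything at `Ã ≠ 0`; regions other than boxes; optimality of `c⋆`, `C_b`, `c₂`; any
statement in lattice dimension `≥ 2` beyond nodes 19/20 (there the `L¹ → L^∞` bound for `D^η_μ G_k` is FALSE,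
node 20).  No cited fact is minted; no hypothesis is assumed; nothing of b04 or of nodes 6–23 is modified.

## ROUTE

Elementary and self-contained above the lineage: the real box operator of `B4BoxCov237` (`boxOpR`, its row formula
`opBoxR_mulVec`, quadratic form `quadFormR_eq`, positivity `boxOpR_form_nonneg`, invertibility `boxOpR_mul_inv`,
symmetry of the inverse `boxOpR_inv_isSymm`, the zero extension `extB`, the box Dirichlet form `dirBox` with
`dirBox_eq_sum_bondSet` / `dirBox_extB_le_bondSum`, the block count `card_filter_blk`), node 8's forward neighbour
`fwd`, node 15's dictionary (`toZFC`, `cubeFam`, `kerY`, `opY_apply`, `kerY_sums`, `lemma22Printed_iff`,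
`lemma22Printed16_cubeFam`, `threshold_metC`), node 19's `lpN_young` / `lpN_bound_mono`, node 20's `lpN_one` /
`lemma22Printed_cubeFam_iff` / `not_lemma22Printed_cubeFam`, Mathlib's `sq_sum_le_card_mul_sum_sq` (Cauchy–Schwarz)
and `Int` division with remainder for the block chart.  A one-dimensional chart (§1: sites ↔ integers of `[0, N)`,
bonds ↔ integers of `[0, N−1)`, the Neumann Laplacian through bond increments) carries the analysis.
-/

namespace Literature.MathematicalPhysics.QuantumFieldTheory.Balaban1983to89.B4Lemma22ZeroBoxDimOne

open Finset Matrix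
open Literature.MathematicalPhysics.QuantumFieldTheory.Balaban1983to89.B4 (Lemma22Printed)
open Literature.MathematicalPhysics.QuantumFieldTheory.Balaban1983to89.B4Reflection242 (boxDom mem_boxDom mem_nbrs blk
  blk_mem_boxDom)
open Literature.MathematicalPhysics.QuantumFieldTheory.Balaban1983to89.B4Green242Bridge (boxNbrs boxBlk)
open Literature.MathematicalPhysics.QuantumFieldTheory.Balaban1983to89.B4BoxCov237 (boxOpR opBoxR_mulVec boxOpR_mul_inv
  boxOpR_inv_isSymm boxOpR_form_nonneg quadFormR_eq uvec uvec_apply_same extB extB_of_mem extB_of_not_mem dirBox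
  dirBox_eq_sum_bondSet bondSet dirBox_extB_le_bondSum card_filter_blk)
open Literature.MathematicalPhysics.QuantumFieldTheory.Balaban1983to89.B4Lemma22ZeroBoxDerivDual (fwd fwd_val_of_mem
  fwd_of_not_mem)
open Literature.MathematicalPhysics.QuantumFieldTheory.Balaban1983to89.B4Ineq19ZeroBoxEta (BoxInst)
open Literature.MathematicalPhysics.QuantumFieldTheory.Balaban1983to89.B4Lemma21Zero (ZeroFieldCube)
open Literature.MathematicalPhysics.QuantumFieldTheory.Balaban1983to89.B4Lemma22ZeroBoxCube (toZFC cubeFam kerY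
  opY_apply kerY_sums lemma22Printed_iff lemma22Printed16_cubeFam threshold_metC toZFC_n supN_le_of_forall)
open Literature.MathematicalPhysics.QuantumFieldTheory.Balaban1983to89.B4Lemma22ZeroBoxLpLq (lpN_young lpN_nonneg
  lpN_bound_mono)
open Literature.MathematicalPhysics.QuantumFieldTheory.Balaban1983to89.B4Lemma22ZeroBoxSharp (lpN_one
  lemma22Printed_cubeFam_iff not_lemma22Printed_cubeFam)

noncomputable section

/-! ## §1 The one-dimensional chart: the sites of a box `[0, N) ⊂ ℤ¹` read as integers -/

section Chart

variable {N : Fin (0 + 1) → ℕ}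

/-- every index of `Fin 1` is `0`. [folklore] -/
theorem fin_eq_zero (i : Fin (0 + 1)) : i = 0 :=
  Fin.ext (by rw [Fin.val_zero]; have := i.2; omega)

/-- a point of `ℤ¹` is the constant function at its coordinate. [folklore] -/
theorem pt_eq (z : Fin (0 + 1) → ℤ) : z = fun _ => z 0 := by
  funext i; rw [fin_eq_zero i]

/-- the integer `z` as a point of `ℤ¹`. [folklore] -/
def ι (z : ℤ) : Fin (0 + 1) → ℤ := fun _ => z

/-- the coordinate of `ι z` is `z`. [folklore] -/
@[simp] theorem ι_apply (z : ℤ) (i : Fin (0 + 1)) : ι z i = z := rfl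

/-- `ι` inverts the coordinate map. [folklore] -/
theorem ι_coord (z : Fin (0 + 1) → ℤ) : ι (z 0) = z := (pt_eq z).symm

/-- `ι` is injective. [folklore] -/
theorem ι_injective : Function.Injective ι := fun z z' h => by
  have := congrFun h 0
  simpa using this

/-- one step forward: `ι z + e₀ = ι (z + 1)`. [folklore] -/
theorem ι_add_uvec (z : ℤ) : ι z + uvec 0 = ι (z + 1) := by
  funext i; rw [fin_eq_zero i]; simp [uvec_apply_same]

/-- the points of `ℤ¹` lying in the box `[0, N)`. [folklore] -/
theorem mem_box_iff (z : ℤ) : ι z ∈ boxDom N ↔ 0 ≤ z ∧ z < N 0 := by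
  rw [mem_boxDom]
  constructor
  · intro h; exact h 0
  · intro h i; rw [fin_eq_zero i]; exact h

/-- the coordinate of a site of the box lies in `[0, N)`. [folklore] -/
theorem coord_bounds (X : ↥(boxDom N)) : 0 ≤ X.1 0 ∧ X.1 0 < N 0 := (mem_boxDom.1 X.2) 0

/-- the site of the box with a given coordinate. [folklore] -/
def site (z : ℤ) (hz : 0 ≤ z ∧ z < N 0) : ↥(boxDom N) := ⟨ι z, (mem_box_iff z).2 hz⟩

/-- the coordinate of `site z` is `z`. [folklore] -/
@[simp] theorem site_coord_val (z : ℤ) (hz : 0 ≤ z ∧ z < N 0) : (site z hz).1 0 = z := rfl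

/-- a site is the site of its coordinate. [folklore] -/
theorem site_coord (X : ↥(boxDom N)) : site (X.1 0) (coord_bounds X) = X := Subtype.ext (ι_coord X.1)

/-- sites with equal coordinates are equal. [folklore] -/
theorem eq_of_coord_eq {X Y : ↥(boxDom N)} (h : X.1 0 = Y.1 0) : X = Y :=
  Subtype.ext (by rw [← ι_coord X.1, ← ι_coord Y.1, h])

/-- the values of a box function along the chart (`0` off the box). [folklore] -/
def val (v : ↥(boxDom N) → ℝ) (z : ℤ) : ℝ := extB N v (ι z)

/-- on the box the chart values are the values. [folklore] -/
theorem val_of_mem (v : ↥(boxDom N) → ℝ) {z : ℤ} (hz : 0 ≤ z ∧ z < N 0) : val v z = v (site z hz) :=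
  extB_of_mem v _

/-- off the box the chart values vanish. [folklore] -/
theorem val_of_not_mem (v : ↥(boxDom N) → ℝ) {z : ℤ} (hz : ¬ (0 ≤ z ∧ z < N 0)) : val v z = 0 :=
  extB_of_not_mem v (by rwa [mem_box_iff])

/-- the chart value at the coordinate of a site. [folklore] -/
theorem val_coord (v : ↥(boxDom N) → ℝ) (X : ↥(boxDom N)) : val v (X.1 0) = v X := by
  rw [val_of_mem v (coord_bounds X), site_coord]

/-- **THE BOND INCREMENTS** of a box function along the chart: `v(z+1) − v(z)` on a bond `{z, z+1} ⊂ [0, N)` of the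
box, `0` for every other integer `z`. [folklore] -/
def bond (v : ↥(boxDom N) → ℝ) (z : ℤ) : ℝ :=
  if 0 ≤ z ∧ z + 1 < (N 0 : ℤ) then val v (z + 1) - val v z else 0

/-- the bond sources of the box are the integers of `[0, N − 1)`. [folklore] -/
theorem bondSet_eq_image : bondSet N 0 = (Finset.Ico (0 : ℤ) ((N 0 : ℤ) - 1)).image ι := by
  ext Z
  unfold bondSet
  rw [Finset.mem_filter, Finset.mem_image]
  constructor
  · rintro ⟨h1, h2⟩
    refine ⟨Z 0, ?_, ι_coord Z⟩
    rw [← ι_coord Z] at h1 h2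
    rw [ι_add_uvec, mem_box_iff] at h2
    rw [mem_box_iff] at h1
    rw [Finset.mem_Ico]; omega
  · rintro ⟨z, hz, rfl⟩
    rw [Finset.mem_Ico] at hz
    rw [ι_add_uvec, mem_box_iff, mem_box_iff]
    omega

/-- **THE BOX DIRICHLET FORM IN ONE DIMENSION** is the sum of the squared increments over the bonds `[0, N − 1)`.
[folklore] -/
theorem dirBox_dimOne (h : (Fin (0 + 1) → ℤ) → ℝ) :
    dirBox N h = ∑ z ∈ Finset.Ico (0 : ℤ) ((N 0 : ℤ) - 1), (h (ι (z + 1)) - h (ι z)) ^ 2 := by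
  rw [dirBox_eq_sum_bondSet, Fin.sum_univ_succ, Fin.sum_univ_zero, add_zero, bondSet_eq_image,
    Finset.sum_image fun z _ z' _ h => ι_injective h]
  refine Finset.sum_congr rfl fun z _ => ?_
  rw [ι_add_uvec]

/-- the squared bond increments over ANY finite set of integers are at most the Dirichlet form. [folklore] -/
theorem sum_bond_sq_le (v : ↥(boxDom N) → ℝ) (S : Finset ℤ) :
    ∑ z ∈ S, bond v z ^ 2 ≤ dirBox N (extB N v) := by
  rw [dirBox_dimOne]
  have h1 : ∑ z ∈ S, bond v z ^ 2
      = ∑ z ∈ S.filter (fun z => 0 ≤ z ∧ z + 1 < (N 0 : ℤ)), (val v (z + 1) - val v z) ^ 2 := by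
    rw [Finset.sum_filter]
    refine Finset.sum_congr rfl fun z _ => ?_
    unfold bond
    split_ifs <;> simp
  rw [h1]
  show _ ≤ ∑ z ∈ Finset.Ico (0 : ℤ) ((N 0 : ℤ) - 1), (val v (z + 1) - val v z) ^ 2
  refine Finset.sum_le_sum_of_subset_of_nonneg ?_ fun _ _ _ => sq_nonneg _
  intro z hz
  rw [Finset.mem_filter] at hz
  rw [Finset.mem_Ico]; omega

/-- telescoping along a chain of `t` consecutive bonds, squared (Cauchy–Schwarz):
`(W(z₀ + t) − W(z₀))² ≤ t·Σ_{s<t} (W(z₀+s+1) − W(z₀+s))²`. [folklore] -/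
theorem sq_sub_le_chain (W : ℤ → ℝ) (z₀ : ℤ) (t : ℕ) :
    (W (z₀ + t) - W z₀) ^ 2 ≤ (t : ℝ) * ∑ s ∈ Finset.range t, (W (z₀ + s + 1) - W (z₀ + s)) ^ 2 := by
  have htel : ∀ t : ℕ, W (z₀ + t) - W z₀ = ∑ s ∈ Finset.range t, (W (z₀ + s + 1) - W (z₀ + s)) := by
    intro t
    induction t with
    | zero => simp
    | succ t ih =>
      rw [Finset.sum_range_succ, ← ih]
      push_cast
      ring_nf
  rw [htel t]
  have h := sq_sum_le_card_mul_sum_sq (s := Finset.range t) (f := fun s => W (z₀ + s + 1) - W (z₀ + s))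
  rw [Finset.card_range] at h
  exact h

/-- membership in a block of side `n`, in coordinates. [folklore] -/
theorem mem_boxBlk_iff {n : ℕ} {X Y : ↥(boxDom N)} : Y ∈ boxBlk n N X ↔ blk n Y.1 = blk n X.1 := by
  unfold boxBlk
  rw [Finset.mem_filter]
  simp only [Finset.mem_univ, true_and]

/-- two sites of one block of side `n ≥ 1` are less than `n` apart. [folklore] -/
theorem coord_near_of_blk {n : ℕ} (hn : 1 ≤ n) {X Y : ↥(boxDom N)} (h : blk n Y.1 = blk n X.1) :
    X.1 0 - n < Y.1 0 ∧ Y.1 0 < X.1 0 + n := by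
  have hq : Y.1 0 / (n : ℤ) = X.1 0 / (n : ℤ) := congrFun h 0
  have hn0 : (0 : ℤ) < n := by exact_mod_cast hn
  have h1 := Int.mul_ediv_add_emod (Y.1 0) n
  have h2 := Int.mul_ediv_add_emod (X.1 0) n
  have h3 := Int.emod_nonneg (Y.1 0) hn0.ne'
  have h4 := Int.emod_lt_of_pos (Y.1 0) hn0
  have h5 := Int.emod_nonneg (X.1 0) hn0.ne'
  have h6 := Int.emod_lt_of_pos (X.1 0) hn0
  rw [hq] at h1
  constructor <;> linarith

/-- the neighbours of a site of a one-dimensional box, in coordinates: `X ± 1`. [folklore] -/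
theorem mem_boxNbrs_dimOne {X Y : ↥(boxDom N)} : Y ∈ boxNbrs N X ↔ Y.1 0 = X.1 0 + 1 ∨ Y.1 0 = X.1 0 - 1 := by
  unfold boxNbrs
  rw [Finset.mem_filter, mem_nbrs]
  simp only [Finset.mem_univ, true_and]
  constructor
  · rintro ⟨i, h | h⟩
    · left
      have := congrFun h 0
      rw [fin_eq_zero i] at this
      simpa using this
    · right
      have := congrFun h 0
      rw [fin_eq_zero i] at this
      simpa using this
  · rintro (h | h)
    · refine ⟨0, Or.inl ?_⟩
      funext j; rw [fin_eq_zero j]; simp [h]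
    · refine ⟨0, Or.inr ?_⟩
      funext j; rw [fin_eq_zero j]; simp [h]

/-- a sum over the sites with a prescribed coordinate is one value or nothing. [folklore] -/
theorem sum_filter_coord (F : ↥(boxDom N) → ℝ) (p : ℤ) :
    ∑ y ∈ Finset.univ.filter (fun y : ↥(boxDom N) => y.1 0 = p), F y
      = if h : 0 ≤ p ∧ p < N 0 then F (site p h) else 0 := by
  split_ifs with h
  · have hS : Finset.univ.filter (fun y : ↥(boxDom N) => y.1 0 = p) = {site p h} := by
      ext y
      rw [Finset.mem_filter, Finset.mem_singleton]
      simp only [Finset.mem_univ, true_and]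
      constructor
      · intro hy; exact eq_of_coord_eq (by rw [hy, site_coord_val])
      · intro hy; rw [hy, site_coord_val]
    rw [hS, Finset.sum_singleton]
  · refine Finset.sum_eq_zero fun y hy => ?_
    rw [Finset.mem_filter] at hy
    exact absurd (hy.2 ▸ coord_bounds y) h

/-- **A NEIGHBOUR SUM IN ONE DIMENSION**: over the box neighbours of `X` = the sites `X + 1`, `X − 1` that lie in the
box. [folklore] -/
theorem sum_boxNbrs_dimOne (F : ↥(boxDom N) → ℝ) (X : ↥(boxDom N)) :
    ∑ y ∈ boxNbrs N X, F y
      = (if h : 0 ≤ X.1 0 + 1 ∧ X.1 0 + 1 < N 0 then F (site (X.1 0 + 1) h) else 0)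
        + (if h : 0 ≤ X.1 0 - 1 ∧ X.1 0 - 1 < N 0 then F (site (X.1 0 - 1) h) else 0) := by
  rw [← sum_filter_coord F (X.1 0 + 1), ← sum_filter_coord F (X.1 0 - 1), ← Finset.sum_union]
  · refine Finset.sum_congr ?_ fun _ _ => rfl
    ext y
    rw [mem_boxNbrs_dimOne, Finset.mem_union, Finset.mem_filter, Finset.mem_filter]
    simp only [Finset.mem_univ, true_and]
  · rw [Finset.disjoint_filter]
    intro y _ h1 h2
    omega

/-- **THE NEUMANN LAPLACIAN IN ONE DIMENSION THROUGH THE BONDS**: `Σ_{y ∼ X}(w X − w y) = β(X − 1) − β(X)` with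
`β = bond w` (a missing bond contributes `0` on both sides). [folklore] -/
theorem nbrSum_eq_bond (w : ↥(boxDom N) → ℝ) (Z : ↥(boxDom N)) :
    ∑ y ∈ boxNbrs N Z, (w Z - w y) = bond w (Z.1 0 - 1) - bond w (Z.1 0) := by
  rw [sum_boxNbrs_dimOne]
  obtain ⟨h0, h1⟩ := coord_bounds Z
  have eZ : val w (Z.1 0) = w Z := val_coord w Z
  unfold bond
  simp only [sub_add_cancel]
  by_cases hp : Z.1 0 + 1 < (N 0 : ℤ)
  · have hp' : 0 ≤ Z.1 0 + 1 ∧ Z.1 0 + 1 < (N 0 : ℤ) := ⟨by omega, hp⟩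
    rw [dif_pos hp', if_pos (show 0 ≤ Z.1 0 ∧ Z.1 0 + 1 < (N 0 : ℤ) from ⟨h0, hp⟩), val_of_mem w hp', eZ]
    by_cases hm : 0 ≤ Z.1 0 - 1
    · have hm' : 0 ≤ Z.1 0 - 1 ∧ Z.1 0 - 1 < (N 0 : ℤ) := ⟨hm, by omega⟩
      rw [dif_pos hm', if_pos (show 0 ≤ Z.1 0 - 1 ∧ Z.1 0 < (N 0 : ℤ) from ⟨hm, h1⟩), val_of_mem w hm']
      ring
    · have hm' : ¬ (0 ≤ Z.1 0 - 1 ∧ Z.1 0 - 1 < (N 0 : ℤ)) := fun h => hm h.1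
      rw [dif_neg hm', if_neg (show ¬ (0 ≤ Z.1 0 - 1 ∧ Z.1 0 < (N 0 : ℤ)) from fun h => hm h.1)]
      ring
  · have hp' : ¬ (0 ≤ Z.1 0 + 1 ∧ Z.1 0 + 1 < (N 0 : ℤ)) := fun h => hp h.2
    rw [dif_neg hp', if_neg (show ¬ (0 ≤ Z.1 0 ∧ Z.1 0 + 1 < (N 0 : ℤ)) from fun h => hp h.2)]
    by_cases hm : 0 ≤ Z.1 0 - 1
    · have hm' : 0 ≤ Z.1 0 - 1 ∧ Z.1 0 - 1 < (N 0 : ℤ) := ⟨hm, by omega⟩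
      rw [dif_pos hm', if_pos (show 0 ≤ Z.1 0 - 1 ∧ Z.1 0 < (N 0 : ℤ) from ⟨hm, h1⟩), val_of_mem w hm', eZ]
      ring
    · have hm' : ¬ (0 ≤ Z.1 0 - 1 ∧ Z.1 0 - 1 < (N 0 : ℤ)) := fun h => hm h.1
      rw [dif_neg hm', if_neg (show ¬ (0 ≤ Z.1 0 - 1 ∧ Z.1 0 < (N 0 : ℤ)) from fun h => hm h.1)]
      ring

/-- **THE FORWARD BOND DIFFERENCE THROUGH THE BONDS**: `w(fwd X) − w(X) = β(X)` (node 8's forward neighbour `fwd`;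
no bond at the right end: both sides vanish). [folklore] -/
theorem fwd_sub_eq_bond (w : ↥(boxDom N) → ℝ) (μ : Fin (0 + 1)) (X : ↥(boxDom N)) :
    w (fwd N μ X) - w X = bond w (X.1 0) := by
  obtain ⟨h0, h1⟩ := coord_bounds X
  have hμ := fin_eq_zero μ
  subst hμ
  have hpt : X.1 + Pi.single (0 : Fin (0 + 1)) 1 = ι (X.1 0 + 1) := by
    conv_lhs => rw [← ι_coord X.1]
    exact ι_add_uvec (X.1 0)
  unfold bond
  by_cases hp : X.1 0 + 1 < (N 0 : ℤ)
  · have hp' : 0 ≤ X.1 0 + 1 ∧ X.1 0 + 1 < (N 0 : ℤ) := ⟨by omega, hp⟩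
    have hmem : X.1 + Pi.single (0 : Fin (0 + 1)) 1 ∈ boxDom N := by rw [hpt, mem_box_iff]; exact hp'
    have hf : fwd N 0 X = site (X.1 0 + 1) hp' :=
      eq_of_coord_eq (by rw [fwd_val_of_mem 0 X hmem, hpt, site_coord_val, ι_apply])
    rw [hf, if_pos (show 0 ≤ X.1 0 ∧ X.1 0 + 1 < (N 0 : ℤ) from ⟨h0, hp⟩), val_of_mem w hp', val_coord]
  · have hmem : X.1 + Pi.single (0 : Fin (0 + 1)) 1 ∉ boxDom N := by
      rw [hpt, mem_box_iff]; exact fun h => hp h.2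
    rw [fwd_of_not_mem 0 X hmem, sub_self, if_neg (show ¬ (0 ≤ X.1 0 ∧ X.1 0 + 1 < (N 0 : ℤ)) from fun h => hp h.2)]

end Chart

/-! ## §2 The pointwise energy bound in one dimension: `v(x)² ≤ (c⋆/n)·⟨v, A v⟩`, `c⋆ = 4 + 2/a` -/

section Key

variable {n : ℕ} {M : Fin (0 + 1) → ℕ} {a m2 : ℝ}

/-- the constant `c⋆ = 4 + 2/a` of the pointwise energy bound. [folklore] -/
def cStar (a : ℝ) : ℝ := 4 + 2 / a

/-- `0 < c⋆`. [folklore] -/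
theorem cStar_pos (ha : 0 < a) : 0 < cStar a := by unfold cStar; positivity

/-- a block of side `n` of the one-dimensional fine box has `n` sites. [folklore] -/
theorem card_boxBlk (hn : 1 ≤ n) (M : Fin (0 + 1) → ℕ) (X : ↥(boxDom fun i => n * M i)) :
    (boxBlk n (fun i => n * M i) X).card = n := by
  have h := card_filter_blk hn M ⟨blk n X.1, blk_mem_boxDom hn X.2⟩
  rw [pow_succ, pow_zero, one_mul] at h
  exact h

/-- the bond part of the quadratic form: `(n²/2)·Σ_x Σ_{x′ ∼ x}(v x − v x′)² ≤ ⟨v, A v⟩` (`A = boxOpR n a m² M`, the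
operator (1.6) in lattice units, `a, m² ≥ 0`). [folklore] -/
theorem bondSum_le (ha : 0 ≤ a) (hm : 0 ≤ m2) (v : ↥(boxDom fun i => n * M i) → ℝ) :
    (n : ℝ) ^ 2 / 2 * ∑ x, ∑ x' ∈ boxNbrs (fun i => n * M i) x, (v x - v x') ^ 2
      ≤ v ⬝ᵥ (boxOpR n a m2 M) *ᵥ v := by
  rw [boxOpR, quadFormR_eq]
  have hY : 0 ≤ m2 * ∑ x, v x ^ 2 := mul_nonneg hm (Finset.sum_nonneg fun _ _ => sq_nonneg _)
  have hZ : 0 ≤ a * ((n : ℝ) ^ (0 + 1))⁻¹ *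
      ∑ β ∈ Finset.univ.image (fun x : ↥(boxDom fun i => n * M i) => blk n x.1),
        (∑ y ∈ Finset.univ.filter (fun y : ↥(boxDom fun i => n * M i) => blk n y.1 = β), v y) ^ 2 :=
    mul_nonneg (mul_nonneg ha (inv_nonneg.2 (pow_nonneg (Nat.cast_nonneg n) _)))
      (Finset.sum_nonneg fun _ _ => sq_nonneg _)
  linarith

/-- the Dirichlet form of the zero extension is at most `(2/n²)·⟨v, A v⟩`. [folklore] -/
theorem dirBox_le (hn : 1 ≤ n) (ha : 0 ≤ a) (hm : 0 ≤ m2) (v : ↥(boxDom fun i => n * M i) → ℝ) :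
    dirBox (fun i => n * M i) (extB (fun i => n * M i) v) ≤ 2 / (n : ℝ) ^ 2 * (v ⬝ᵥ (boxOpR n a m2 M) *ᵥ v) := by
  have hn' : (0 : ℝ) < n := by exact_mod_cast hn
  have h1 := dirBox_extB_le_bondSum (N := fun i => n * M i) v
  have h2 := bondSum_le ha hm v
  have h3 : (n : ℝ) ^ 2 * dirBox (fun i => n * M i) (extB (fun i => n * M i) v)
      ≤ (n : ℝ) ^ 2 * ∑ x, ∑ x' ∈ boxNbrs (fun i => n * M i) x, (v x - v x') ^ 2 :=
    mul_le_mul_of_nonneg_left h1 (sq_nonneg _)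
  rw [div_mul_eq_mul_div, le_div_iff₀ (by positivity : (0 : ℝ) < (n : ℝ) ^ 2)]
  linarith

/-- the squared sum over the block of `X`: `(Σ_{blk y = blk X} v y)² ≤ (n/a)·⟨v, A v⟩` (`a > 0`). [folklore] -/
theorem blockSum_sq_le (hn : 1 ≤ n) (ha : 0 < a) (hm : 0 ≤ m2) (v : ↥(boxDom fun i => n * M i) → ℝ)
    (X : ↥(boxDom fun i => n * M i)) :
    (∑ y ∈ boxBlk n (fun i => n * M i) X, v y) ^ 2 ≤ (n : ℝ) / a * (v ⬝ᵥ (boxOpR n a m2 M) *ᵥ v) := by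
  have hn' : (0 : ℝ) < n := by exact_mod_cast hn
  set Z := ∑ β ∈ Finset.univ.image (fun x : ↥(boxDom fun i => n * M i) => blk n x.1),
      (∑ y ∈ Finset.univ.filter (fun y : ↥(boxDom fun i => n * M i) => blk n y.1 = β), v y) ^ 2 with hZdef
  have hB : 0 ≤ (n : ℝ) ^ 2 / 2 * ∑ x, ∑ x' ∈ boxNbrs (fun i => n * M i) x, (v x - v x') ^ 2 := by positivity
  have hY : 0 ≤ m2 * ∑ x, v x ^ 2 := mul_nonneg hm (Finset.sum_nonneg fun _ _ => sq_nonneg _)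
  have hmem : blk n X.1 ∈ Finset.univ.image (fun x : ↥(boxDom fun i => n * M i) => blk n x.1) :=
    Finset.mem_image_of_mem _ (Finset.mem_univ X)
  have hsingle : (∑ y ∈ boxBlk n (fun i => n * M i) X, v y) ^ 2 ≤ Z := by
    have h := Finset.single_le_sum
      (f := fun β => (∑ y ∈ Finset.univ.filter (fun y : ↥(boxDom fun i => n * M i) => blk n y.1 = β), v y) ^ 2)
      (fun _ _ => sq_nonneg _) hmem
    exact h
  have hQ : v ⬝ᵥ (boxOpR n a m2 M) *ᵥ v
      = (n : ℝ) ^ 2 / 2 * (∑ x, ∑ x' ∈ boxNbrs (fun i => n * M i) x, (v x - v x') ^ 2) + m2 * (∑ x, v x ^ 2)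
        + a * ((n : ℝ) ^ (0 + 1))⁻¹ * Z := by
    rw [boxOpR, quadFormR_eq]
  have hpow : ((n : ℝ) ^ (0 + 1)) = n := by rw [pow_succ, pow_zero, one_mul]
  have hkey : (n : ℝ) / a * (a * ((n : ℝ) ^ (0 + 1))⁻¹ * Z) = Z := by
    rw [hpow]; field_simp
  calc (∑ y ∈ boxBlk n (fun i => n * M i) X, v y) ^ 2 ≤ Z := hsingle
    _ = (n : ℝ) / a * (a * ((n : ℝ) ^ (0 + 1))⁻¹ * Z) := hkey.symm
    _ ≤ (n : ℝ) / a * (v ⬝ᵥ (boxOpR n a m2 M) *ᵥ v) :=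
        mul_le_mul_of_nonneg_left (by rw [hQ]; linarith) (by positivity)

/-- **THE IN-BLOCK OSCILLATION**: two sites of one block differ by at most `√(n·E_□(v))` —
`(v X − v Y)² ≤ n·E_□(v)` (telescoping along the `< n` consecutive bonds between them, all inside the box;
Cauchy–Schwarz). [folklore] -/
theorem sq_sub_le_of_blk (hn : 1 ≤ n) (v : ↥(boxDom fun i => n * M i) → ℝ) {X Y : ↥(boxDom fun i => n * M i)}
    (h : blk n Y.1 = blk n X.1) :
    (v X - v Y) ^ 2 ≤ (n : ℝ) * dirBox (fun i => n * M i) (extB (fun i => n * M i) v) := by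
  wlog hle : X.1 0 ≤ Y.1 0 generalizing X Y
  · have e : (v X - v Y) ^ 2 = (v Y - v X) ^ 2 := by ring
    rw [e]
    exact this h.symm (le_of_lt (not_le.1 hle))
  obtain ⟨_, h2⟩ := coord_near_of_blk hn h
  obtain ⟨hX0, hX1⟩ := coord_bounds X
  obtain ⟨hY0, hY1⟩ := coord_bounds Y
  set t : ℕ := (Y.1 0 - X.1 0).toNat with ht
  have htz : (t : ℤ) = Y.1 0 - X.1 0 := Int.toNat_of_nonneg (by linarith)
  have htn : t < n := by omega
  have htn' : (t : ℝ) ≤ n := by exact_mod_cast htn.le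
  have hchain := sq_sub_le_chain (val v) (X.1 0) t
  have e1 : val v (X.1 0) = v X := val_coord v X
  have e2 : val v (X.1 0 + t) = v Y := by rw [htz, add_sub_cancel, val_coord]
  rw [e1, e2] at hchain
  have hterm : ∀ s ∈ Finset.range t,
      (val v (X.1 0 + s + 1) - val v (X.1 0 + s)) ^ 2 = bond v (X.1 0 + s) ^ 2 := by
    intro s hs
    rw [Finset.mem_range] at hs
    have hs' : (s : ℤ) + 1 ≤ t := by exact_mod_cast hs
    unfold bond
    rw [if_pos]
    constructor
    · have : (0 : ℤ) ≤ s := Nat.cast_nonneg s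
      linarith
    · linarith
  rw [Finset.sum_congr rfl hterm] at hchain
  have hinj : Set.InjOn (fun s : ℕ => X.1 0 + s) ↑(Finset.range t) := by
    intro s _ s' _ hss'
    have : (s : ℤ) = s' := by simpa using hss'
    exact_mod_cast this
  have hsum : ∑ s ∈ Finset.range t, bond v (X.1 0 + s) ^ 2
      ≤ dirBox (fun i => n * M i) (extB (fun i => n * M i) v) := by
    rw [← Finset.sum_image (f := fun z => bond v z ^ 2) hinj]
    exact sum_bond_sq_le v _
  have e : (v X - v Y) ^ 2 = (v Y - v X) ^ 2 := by ring
  rw [e]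
  calc (v Y - v X) ^ 2 ≤ (t : ℝ) * ∑ s ∈ Finset.range t, bond v (X.1 0 + s) ^ 2 := hchain
    _ ≤ (n : ℝ) * dirBox (fun i => n * M i) (extB (fun i => n * M i) v) :=
        mul_le_mul htn' hsum (Finset.sum_nonneg fun _ _ => sq_nonneg _) (Nat.cast_nonneg n)

/-- **THE POINTWISE ENERGY BOUND IN ONE DIMENSION**: for every function `v` on the fine box `[0, nM) ⊂ ℤ¹` and
every site `X`, `v(X)² ≤ (c⋆/n)·⟨v, (n²(−Δ^N) + m² + (a/n)Q*Q) v⟩`, `c⋆ = 4 + 2/a`, uniformly in `n ≥ 1`, the box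
and `m² ≥ 0` — `n·v(X) = (block sum) + Σ_{y in the block}(v X − v y)`, the block sum is controlled by the
averaging term and the in-block oscillation by `n·E_□(v) ≤ (2/n)⟨v, Av⟩`. [folklore] -/
theorem sq_le_energy (hn : 1 ≤ n) (ha : 0 < a) (hm : 0 ≤ m2) (v : ↥(boxDom fun i => n * M i) → ℝ)
    (X : ↥(boxDom fun i => n * M i)) :
    v X ^ 2 ≤ cStar a / n * (v ⬝ᵥ (boxOpR n a m2 M) *ᵥ v) := by
  have hn' : (0 : ℝ) < n := by exact_mod_cast hn
  set Q := v ⬝ᵥ (boxOpR n a m2 M) *ᵥ v with hQdef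
  have hQ0 : 0 ≤ Q := boxOpR_form_nonneg n ha.le hm M v
  set B := boxBlk n (fun i => n * M i) X with hBdef
  have hcard : B.card = n := card_boxBlk hn M X
  -- `n · v X = S + D`
  have hsplit : (n : ℝ) * v X = (∑ y ∈ B, v y) + ∑ y ∈ B, (v X - v y) := by
    rw [← Finset.sum_add_distrib]
    simp only [add_sub_cancel]
    rw [Finset.sum_const, hcard, nsmul_eq_mul]
  have hS : (∑ y ∈ B, v y) ^ 2 ≤ (n : ℝ) / a * Q := blockSum_sq_le hn ha hm v X
  have hE : dirBox (fun i => n * M i) (extB (fun i => n * M i) v) ≤ 2 / (n : ℝ) ^ 2 * Q := dirBox_le hn ha.le hm v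
  have hD1 : (∑ y ∈ B, (v X - v y)) ^ 2 ≤ (n : ℝ) * ∑ y ∈ B, (v X - v y) ^ 2 := by
    have h := sq_sum_le_card_mul_sum_sq (s := B) (f := fun y => v X - v y)
    rw [hcard] at h
    exact h
  have hD2 : ∑ y ∈ B, (v X - v y) ^ 2 ≤ (n : ℝ) * ((n : ℝ) * (2 / (n : ℝ) ^ 2 * Q)) := by
    calc ∑ y ∈ B, (v X - v y) ^ 2
        ≤ ∑ _y ∈ B, (n : ℝ) * dirBox (fun i => n * M i) (extB (fun i => n * M i) v) :=
          Finset.sum_le_sum fun y hy => sq_sub_le_of_blk hn v (mem_boxBlk_iff.1 hy)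
      _ = (n : ℝ) * ((n : ℝ) * dirBox (fun i => n * M i) (extB (fun i => n * M i) v)) := by
          rw [Finset.sum_const, hcard, nsmul_eq_mul]
      _ ≤ (n : ℝ) * ((n : ℝ) * (2 / (n : ℝ) ^ 2 * Q)) :=
          mul_le_mul_of_nonneg_left (mul_le_mul_of_nonneg_left hE hn'.le) hn'.le
  have hD3 : (n : ℝ) * ((n : ℝ) * (2 / (n : ℝ) ^ 2 * Q)) = 2 * Q := by
    field_simp
  rw [hD3] at hD2
  -- `(n v X)² ≤ 2S² + 2D² ≤ 2(n/a)Q + 4nQ`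
  have hsq : ((n : ℝ) * v X) ^ 2 ≤ 2 * ((n : ℝ) / a * Q) + 2 * ((n : ℝ) * (2 * Q)) := by
    rw [hsplit]
    nlinarith [sq_nonneg ((∑ y ∈ B, v y) - ∑ y ∈ B, (v X - v y)), hS, hD1, hD2,
      mul_le_mul_of_nonneg_left hD2 hn'.le]
  have hc : cStar a / n * Q = (2 * ((n : ℝ) / a * Q) + 2 * ((n : ℝ) * (2 * Q))) / (n : ℝ) ^ 2 := by
    unfold cStar
    field_simp
    ring
  rw [hc, le_div_iff₀ (by positivity : (0 : ℝ) < (n : ℝ) ^ 2)]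
  calc v X ^ 2 * (n : ℝ) ^ 2 = ((n : ℝ) * v X) ^ 2 := by ring
    _ ≤ _ := hsq

end Key

/-! ## §3 The Green's function `G = A⁻¹` of the one-dimensional fine box: entries `≤ c⋆/n`, block sums `≤ c⋆` -/

section Green

variable {n : ℕ} {M : Fin (0 + 1) → ℕ} {a m2 : ℝ}

/-- the column `x` of `G = A⁻¹` solves `A·G(·, x) = δ_x`. [folklore] -/
theorem mulVec_col (hn : 1 ≤ n) (ha : 0 < a) (hm : 0 ≤ m2) (hM : ∀ i, 1 ≤ M i)
    (x : ↥(boxDom fun i => n * M i)) :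
    (boxOpR n a m2 M) *ᵥ (fun y => (boxOpR n a m2 M)⁻¹ y x) = Pi.single x 1 := by
  funext z
  have h := congrFun (congrFun (boxOpR_mul_inv hn ha hm hM) z) x
  rw [Matrix.mul_apply, Matrix.one_apply] at h
  rw [Matrix.mulVec, dotProduct, h, Pi.single_apply]

/-- the energy of the column `x` is the diagonal entry: `⟨G(·, x), A G(·, x)⟩ = G(x, x)`. [folklore] -/
theorem col_energy (hn : 1 ≤ n) (ha : 0 < a) (hm : 0 ≤ m2) (hM : ∀ i, 1 ≤ M i)
    (x : ↥(boxDom fun i => n * M i)) :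
    (fun y => (boxOpR n a m2 M)⁻¹ y x) ⬝ᵥ (boxOpR n a m2 M) *ᵥ (fun y => (boxOpR n a m2 M)⁻¹ y x)
      = (boxOpR n a m2 M)⁻¹ x x := by
  rw [mulVec_col hn ha hm hM x, dotProduct_single, mul_one]

/-- **THE DIAGONAL OF THE GREEN'S FUNCTION**: `G(x, x) ≤ c⋆/n`. [folklore] -/
theorem diag_le (hn : 1 ≤ n) (ha : 0 < a) (hm : 0 ≤ m2) (hM : ∀ i, 1 ≤ M i)
    (x : ↥(boxDom fun i => n * M i)) :
    (boxOpR n a m2 M)⁻¹ x x ≤ cStar a / n := by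
  have h1 := sq_le_energy hn ha hm (fun y => (boxOpR n a m2 M)⁻¹ y x) x
  rw [col_energy hn ha hm hM x] at h1
  have hc : 0 ≤ cStar a / n := div_nonneg (cStar_pos ha).le (Nat.cast_nonneg n)
  by_cases hg : (boxOpR n a m2 M)⁻¹ x x ≤ 0
  · exact hg.trans hc
  · push Not at hg
    nlinarith

/-- the diagonal of the Green's function is non-negative. [folklore] -/
theorem diag_nonneg (hn : 1 ≤ n) (ha : 0 < a) (hm : 0 ≤ m2) (hM : ∀ i, 1 ≤ M i)
    (x : ↥(boxDom fun i => n * M i)) :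
    0 ≤ (boxOpR n a m2 M)⁻¹ x x := by
  rw [← col_energy hn ha hm hM x]
  exact boxOpR_form_nonneg n ha.le hm M _

/-- **THE ENTRIES OF THE GREEN'S FUNCTION**: `|G(x′, x)| ≤ c⋆/n`, uniformly in the box. [folklore] -/
theorem entry_le (hn : 1 ≤ n) (ha : 0 < a) (hm : 0 ≤ m2) (hM : ∀ i, 1 ≤ M i)
    (x' x : ↥(boxDom fun i => n * M i)) :
    |(boxOpR n a m2 M)⁻¹ x' x| ≤ cStar a / n := by
  have h1 := sq_le_energy hn ha hm (fun y => (boxOpR n a m2 M)⁻¹ y x) x'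
  rw [col_energy hn ha hm hM x] at h1
  have h2 := diag_le hn ha hm hM x
  have hc : 0 ≤ cStar a / n := div_nonneg (cStar_pos ha).le (Nat.cast_nonneg n)
  have h3 : ((boxOpR n a m2 M)⁻¹ x' x) ^ 2 ≤ (cStar a / n) ^ 2 :=
    h1.trans (by rw [sq]; exact mul_le_mul_of_nonneg_left h2 hc)
  exact abs_le_of_sq_le_sq h3 hc

/-- **THE BLOCK SUMS OF A GREEN COLUMN**: `|Σ_{y in a block} G(y, x)| ≤ c⋆`. [folklore] -/
theorem blockSum_col_le (hn : 1 ≤ n) (ha : 0 < a) (hm : 0 ≤ m2) (hM : ∀ i, 1 ≤ M i)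
    (x Z : ↥(boxDom fun i => n * M i)) :
    |∑ y ∈ boxBlk n (fun i => n * M i) Z, (boxOpR n a m2 M)⁻¹ y x| ≤ cStar a := by
  have hn' : (0 : ℝ) < n := by exact_mod_cast hn
  calc |∑ y ∈ boxBlk n (fun i => n * M i) Z, (boxOpR n a m2 M)⁻¹ y x|
      ≤ ∑ y ∈ boxBlk n (fun i => n * M i) Z, |(boxOpR n a m2 M)⁻¹ y x| := Finset.abs_sum_le_sum_abs _ _
    _ ≤ ∑ _y ∈ boxBlk n (fun i => n * M i) Z, cStar a / n := Finset.sum_le_sum fun y _ => entry_le hn ha hm hM y x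
    _ = cStar a := by rw [Finset.sum_const, card_boxBlk hn M Z, nsmul_eq_mul]; field_simp

end Green

/-! ## §4 The bonds of a Green column: second differences `O(1/n³)` off the source, energy `O(1/n³)`, hence every
bond is `O(1/n²)` (the window argument) -/

section Bonds

variable {n : ℕ} {M : Fin (0 + 1) → ℕ} {a m2 m2plus : ℝ}

/-- the constant `C_b = 2(m₊² + a)c⋆ + 1 + 8c⋆` of the bond bound. [folklore] -/
def Cb (a m2plus : ℝ) : ℝ := 2 * (m2plus + a) * cStar a + 1 + 8 * cStar a

/-- **THE SITE EQUATION OFF THE SOURCE**: at a site `Z ≠ x` the column `w = G(·, x)` satisfies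
`n²(β(Z−1) − β(Z)) + m² w(Z) + (a/n)·(block sum of w) = 0`, whence `|β(Z−1) − β(Z)| ≤ (m₊² + a)c⋆/n³`.
[folklore] -/
theorem bond_step_site (hn : 1 ≤ n) (ha : 0 < a) (hm : 0 ≤ m2) (hm' : m2 ≤ m2plus) (hM : ∀ i, 1 ≤ M i)
    (x Z : ↥(boxDom fun i => n * M i)) (hZ : Z ≠ x) :
    |bond (fun y => (boxOpR n a m2 M)⁻¹ y x) (Z.1 0 - 1) - bond (fun y => (boxOpR n a m2 M)⁻¹ y x) (Z.1 0)|
      ≤ (m2plus + a) * cStar a / (n : ℝ) ^ 3 := by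
  have hn' : (0 : ℝ) < n := by exact_mod_cast hn
  obtain ⟨w, hw⟩ : ∃ w : ↥(boxDom fun i => n * M i) → ℝ, w = fun y => (boxOpR n a m2 M)⁻¹ y x := ⟨_, rfl⟩
  rw [← hw]
  have hrow := congrFun (mulVec_col hn ha hm hM x) Z
  rw [← hw, Pi.single_apply, if_neg hZ, boxOpR, opBoxR_mulVec, nbrSum_eq_bond] at hrow
  have hpow : ((n : ℝ) ^ (0 + 1)) = n := by rw [pow_succ, pow_zero, one_mul]
  rw [hpow] at hrow
  have hwZ : |w Z| ≤ cStar a / n := by rw [hw]; exact entry_le hn ha hm hM Z x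
  have hS : |∑ y ∈ boxBlk n (fun i => n * M i) Z, w y| ≤ cStar a := by
    rw [hw]; exact blockSum_col_le hn ha hm hM x Z
  have hc : 0 ≤ cStar a / n := div_nonneg (cStar_pos ha).le hn'.le
  have e : (n : ℝ) ^ 2 * (bond w (Z.1 0 - 1) - bond w (Z.1 0))
      = -(m2 * w Z + a * (n : ℝ)⁻¹ * ∑ y ∈ boxBlk n (fun i => n * M i) Z, w y) := by
    linarith
  have h1 : (n : ℝ) ^ 2 * |bond w (Z.1 0 - 1) - bond w (Z.1 0)| ≤ (m2plus + a) * cStar a / n := by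
    rw [← abs_of_nonneg (sq_nonneg (n : ℝ)), ← abs_mul, e, abs_neg]
    calc |m2 * w Z + a * (n : ℝ)⁻¹ * ∑ y ∈ boxBlk n (fun i => n * M i) Z, w y|
        ≤ |m2 * w Z| + |a * (n : ℝ)⁻¹ * ∑ y ∈ boxBlk n (fun i => n * M i) Z, w y| := abs_add_le _ _
      _ = m2 * |w Z| + a * (n : ℝ)⁻¹ * |∑ y ∈ boxBlk n (fun i => n * M i) Z, w y| := by
          rw [abs_mul, abs_mul, abs_of_nonneg hm, abs_of_nonneg (by positivity : (0 : ℝ) ≤ a * (n : ℝ)⁻¹)]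
      _ ≤ m2 * (cStar a / n) + a * (n : ℝ)⁻¹ * cStar a :=
          add_le_add (mul_le_mul_of_nonneg_left hwZ hm) (mul_le_mul_of_nonneg_left hS (by positivity))
      _ = (m2 + a) * (cStar a / n) := by ring
      _ ≤ (m2plus + a) * (cStar a / n) := mul_le_mul_of_nonneg_right (by linarith) hc
      _ = (m2plus + a) * cStar a / n := by ring
  rw [le_div_iff₀ (by positivity : (0 : ℝ) < (n : ℝ) ^ 3)]
  calc |bond w (Z.1 0 - 1) - bond w (Z.1 0)| * (n : ℝ) ^ 3
      = (n : ℝ) ^ 2 * |bond w (Z.1 0 - 1) - bond w (Z.1 0)| * n := by ring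
    _ ≤ (m2plus + a) * cStar a / n * n := mul_le_mul_of_nonneg_right h1 hn'.le
    _ = (m2plus + a) * cStar a := by field_simp

/-- **THE SECOND DIFFERENCES OF A GREEN COLUMN**: `|β(z−1) − β(z)| ≤ (m₊² + a)c⋆/n³` at EVERY integer `z` other than
the source coordinate (off the box both bonds vanish). [folklore] -/
theorem bond_step (hn : 1 ≤ n) (ha : 0 < a) (hm : 0 ≤ m2) (hm' : m2 ≤ m2plus) (hM : ∀ i, 1 ≤ M i)
    (x : ↥(boxDom fun i => n * M i)) (z : ℤ) (hz : z ≠ x.1 0) :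
    |bond (fun y => (boxOpR n a m2 M)⁻¹ y x) (z - 1) - bond (fun y => (boxOpR n a m2 M)⁻¹ y x) z|
      ≤ (m2plus + a) * cStar a / (n : ℝ) ^ 3 := by
  by_cases hbox : 0 ≤ z ∧ z < ((fun i => n * M i) (0 : Fin (0 + 1)) : ℤ)
  · have hne : site z hbox ≠ x := fun h => hz (by rw [← h, site_coord_val])
    exact bond_step_site hn ha hm hm' hM x (site z hbox) hne
  · have h1 : bond (fun y => (boxOpR n a m2 M)⁻¹ y x) (z - 1) = 0 := by
      unfold bond; rw [if_neg]; omega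
    have h2 : bond (fun y => (boxOpR n a m2 M)⁻¹ y x) z = 0 := by
      unfold bond; rw [if_neg]; omega
    rw [h1, h2, sub_zero, abs_zero]
    exact div_nonneg (mul_nonneg (by linarith) (cStar_pos ha).le) (pow_nonneg (Nat.cast_nonneg n) 3)

/-- **THE BOND ENERGY OF A GREEN COLUMN**: `Σ_{z ∈ S} β(z)² ≤ E_□(w) ≤ (2/n²)G(x, x) ≤ 2c⋆/n³` for every finite
set of integers `S`. [folklore] -/
theorem bond_energy (hn : 1 ≤ n) (ha : 0 < a) (hm : 0 ≤ m2) (hM : ∀ i, 1 ≤ M i)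
    (x : ↥(boxDom fun i => n * M i)) (S : Finset ℤ) :
    ∑ z ∈ S, bond (fun y => (boxOpR n a m2 M)⁻¹ y x) z ^ 2 ≤ 2 * cStar a / (n : ℝ) ^ 3 := by
  have hn' : (0 : ℝ) < n := by exact_mod_cast hn
  have h1 := sum_bond_sq_le (fun y => (boxOpR n a m2 M)⁻¹ y x) S
  have h2 := dirBox_le hn ha.le hm (fun y => (boxOpR n a m2 M)⁻¹ y x)
  rw [col_energy hn ha hm hM x] at h2
  have h3 := diag_le hn ha hm hM x
  calc ∑ z ∈ S, bond (fun y => (boxOpR n a m2 M)⁻¹ y x) z ^ 2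
      ≤ 2 / (n : ℝ) ^ 2 * (boxOpR n a m2 M)⁻¹ x x := h1.trans h2
    _ ≤ 2 / (n : ℝ) ^ 2 * (cStar a / n) := mul_le_mul_of_nonneg_left h3 (by positivity)
    _ = 2 * cStar a / (n : ℝ) ^ 3 := by rw [div_mul_div_comm, ← pow_succ]

/-- **THE WINDOW LEMMA** (elementary): a real sequence with increments `≤ ε` on `[0, n)` and `Σ_{j<n} b_j² ≤ E`
has `|b₀| ≤ 2nε` or `b₀² ≤ 4E/n` — if `|b₀| > 2nε` then `|b_j| ≥ |b₀|/2` throughout the window. [folklore] -/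
theorem window (b : ℕ → ℝ) {n : ℕ} (hn : 1 ≤ n) {ε E : ℝ} (hε : 0 ≤ ε)
    (hstep : ∀ j, j + 1 < n → |b (j + 1) - b j| ≤ ε) (hE : ∑ j ∈ Finset.range n, b j ^ 2 ≤ E) :
    |b 0| ≤ 2 * n * ε ∨ b 0 ^ 2 ≤ 4 * E / n := by
  have hn' : (0 : ℝ) < n := by exact_mod_cast hn
  have drift : ∀ j, j < n → |b j - b 0| ≤ j * ε := by
    intro j
    induction j with
    | zero => intro _; simp
    | succ j ih =>
      intro hj
      have h1 := ih (by omega)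
      have h2 := hstep j hj
      calc |b (j + 1) - b 0| = |(b (j + 1) - b j) + (b j - b 0)| := by ring_nf
        _ ≤ |b (j + 1) - b j| + |b j - b 0| := abs_add_le _ _
        _ ≤ ε + j * ε := add_le_add h2 h1
        _ = ((j + 1 : ℕ) : ℝ) * ε := by push_cast; ring
  by_cases hb : |b 0| ≤ 2 * n * ε
  · exact Or.inl hb
  · right
    push Not at hb
    have hlow : ∀ j ∈ Finset.range n, b 0 ^ 2 / 4 ≤ b j ^ 2 := by
      intro j hj
      rw [Finset.mem_range] at hj
      have h1 := drift j hj
      have hjn : (j : ℝ) * ε ≤ n * ε := mul_le_mul_of_nonneg_right (by exact_mod_cast hj.le) hε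
      have h2 : |b 0| / 2 ≤ |b j| := by
        have := abs_sub_abs_le_abs_sub (b 0) (b j)
        rw [abs_sub_comm] at this
        linarith
      nlinarith [mul_nonneg (sub_nonneg.2 h2) (by positivity : (0 : ℝ) ≤ |b j| + |b 0| / 2),
        sq_abs (b j), sq_abs (b 0)]
    have hsum : (n : ℝ) * (b 0 ^ 2 / 4) ≤ ∑ j ∈ Finset.range n, b j ^ 2 := by
      have := Finset.sum_le_sum hlow
      rwa [Finset.sum_const, Finset.card_range, nsmul_eq_mul] at this
    rw [le_div_iff₀ hn']
    linarith

/-- `1 + 8c⋆` dominates `√(8c⋆)` without square roots: `8c⋆ ≤ (1 + 8c⋆)²`. [folklore] -/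
theorem eight_cStar_le_sq (ha : 0 < a) : 8 * cStar a ≤ (1 + 8 * cStar a) ^ 2 := by
  nlinarith [cStar_pos ha]

/-- **EVERY BOND OF A GREEN COLUMN IS `O(1/n²)`**: `|β(z₀)| ≤ C_b/n²` for every integer `z₀`, `C_b = 2(m₊² + a)c⋆ +
1 + 8c⋆` — the window lemma on the `n` bonds starting at `z₀` and pointing away from the source. [folklore] -/
theorem bond_le (hn : 1 ≤ n) (ha : 0 < a) (hm : 0 ≤ m2) (hm' : m2 ≤ m2plus) (hM : ∀ i, 1 ≤ M i)
    (x : ↥(boxDom fun i => n * M i)) (z₀ : ℤ) :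
    |bond (fun y => (boxOpR n a m2 M)⁻¹ y x) z₀| ≤ Cb a m2plus / (n : ℝ) ^ 2 := by
  have hn' : (0 : ℝ) < n := by exact_mod_cast hn
  have hmp : 0 ≤ m2plus + a := by linarith
  have hc := cStar_pos ha
  set w : ↥(boxDom fun i => n * M i) → ℝ := fun y => (boxOpR n a m2 M)⁻¹ y x with hw
  set ε : ℝ := (m2plus + a) * cStar a / (n : ℝ) ^ 3 with hεdef
  have hε : 0 ≤ ε := div_nonneg (mul_nonneg hmp hc.le) (pow_nonneg hn'.le 3)
  -- the direction away from the source
  set σ : ℤ := if x.1 0 ≤ z₀ then 1 else -1 with hσ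
  set b : ℕ → ℝ := fun j => bond w (z₀ + σ * j) with hb
  have hb0 : b 0 = bond w z₀ := by simp [hb]
  have hstep : ∀ j : ℕ, j + 1 < n → |b (j + 1) - b j| ≤ ε := by
    intro j _
    by_cases hx : x.1 0 ≤ z₀
    · have hσ1 : σ = 1 := by simp [hσ, hx]
      have h := bond_step hn ha hm hm' hM x (z₀ + (j + 1)) (by omega)
      have e1 : b (j + 1) = bond w (z₀ + (j + 1)) := by
        show bond w (z₀ + σ * ((j + 1 : ℕ) : ℤ)) = _
        rw [hσ1]; congr 1; push_cast; ring
      have e2 : b j = bond w (z₀ + (j + 1) - 1) := by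
        show bond w (z₀ + σ * (j : ℤ)) = _
        rw [hσ1]; congr 1; ring
      rw [e1, e2, abs_sub_comm]
      exact h
    · have hσ1 : σ = -1 := by simp [hσ, hx]
      have h := bond_step hn ha hm hm' hM x (z₀ - j) (by omega)
      have e1 : b (j + 1) = bond w (z₀ - j - 1) := by
        show bond w (z₀ + σ * ((j + 1 : ℕ) : ℤ)) = _
        rw [hσ1]; congr 1; push_cast; ring
      have e2 : b j = bond w (z₀ - j) := by
        show bond w (z₀ + σ * (j : ℤ)) = _
        rw [hσ1]; congr 1; ring
      rw [e1, e2]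
      exact h
  have hσ0 : σ ≠ 0 := by rw [hσ]; split_ifs <;> decide
  have hinj : Set.InjOn (fun j : ℕ => z₀ + σ * j) ↑(Finset.range n) := by
    intro j _ j' _ hjj'
    have h : σ * (j : ℤ) = σ * j' := by simpa using hjj'
    exact_mod_cast mul_left_cancel₀ hσ0 h
  have hE : ∑ j ∈ Finset.range n, b j ^ 2 ≤ 2 * cStar a / (n : ℝ) ^ 3 := by
    have h := bond_energy hn ha hm hM x ((Finset.range n).image fun j : ℕ => z₀ + σ * j)
    rw [Finset.sum_image hinj] at h
    exact h
  have hCb : 0 ≤ Cb a m2plus := by unfold Cb; positivity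
  rcases window b hn hε hstep hE with h | h
  · rw [hb0] at h
    calc |bond w z₀| ≤ 2 * n * ε := h
      _ = 2 * (m2plus + a) * cStar a / (n : ℝ) ^ 2 := by rw [hεdef]; field_simp
      _ ≤ Cb a m2plus / (n : ℝ) ^ 2 := by
          unfold Cb
          exact div_le_div_of_nonneg_right (by nlinarith) (pow_nonneg hn'.le 2)
  · rw [hb0] at h
    have h' : bond w z₀ ^ 2 ≤ ((1 + 8 * cStar a) / (n : ℝ) ^ 2) ^ 2 := by
      calc bond w z₀ ^ 2 ≤ 4 * (2 * cStar a / (n : ℝ) ^ 3) / n := h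
        _ = 8 * cStar a / ((n : ℝ) ^ 2) ^ 2 := by field_simp; ring
        _ ≤ (1 + 8 * cStar a) ^ 2 / ((n : ℝ) ^ 2) ^ 2 :=
            div_le_div_of_nonneg_right (eight_cStar_le_sq ha) (by positivity)
        _ = ((1 + 8 * cStar a) / (n : ℝ) ^ 2) ^ 2 := by rw [div_pow]
    calc |bond w z₀| ≤ (1 + 8 * cStar a) / (n : ℝ) ^ 2 := abs_le_of_sq_le_sq h' (by positivity)
      _ ≤ Cb a m2plus / (n : ℝ) ^ 2 := by
          unfold Cb
          exact div_le_div_of_nonneg_right (by nlinarith) (pow_nonneg hn'.le 2)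

/-- `c⋆ ≤ C_b` (for `m₊² + a ≥ 0`). [folklore] -/
theorem cStar_le_Cb (ha : 0 < a) (hmp : 0 ≤ m2plus + a) : cStar a ≤ Cb a m2plus := by
  unfold Cb; nlinarith [cStar_pos ha]

end Bonds

/-! ## §5 The three kernels of (2.17) on the one-dimensional zero-field cubes: entries `≤ C/n`, and the
quantitative core for ALL `0 ≤ t ≤ s ≤ 1` -/

section Kernels

variable {ℓ : ℕ} {m2plus : ℝ}

/-- **UNIFORM ENTRY BOUNDS IN ONE DIMENSION**: one constant `P > 0` with `|T(x′, x)| ≤ P/n`, `n = (ℓ+1)^k` the number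
of sites per unit length, for all three kernels `T ∈ {G, n·∂^f G, G·(n·∂^f)*}` of (2.17) on every member of the
zero-field cube family over `ℤ¹`. [folklore] -/
theorem kerY_entry_le (a : ℝ) (ha : 0 < a) :
    ∃ P : ℝ, 0 < P ∧ ∀ (i : BoxInst 0 ℓ m2plus) (m : Fin 3) (μ : Fin (0 + 1))
      (x' x : ↥(boxDom fun j => (ℓ + 1) ^ i.k * i.M j)),
        |kerY a i m μ x' x| ≤ P / (((ℓ + 1) ^ i.k : ℕ) : ℝ) := by
  refine ⟨max 1 (Cb a m2plus), lt_max_of_lt_left one_pos, fun i m μ x' x => ?_⟩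
  have hn : 1 ≤ (ℓ + 1) ^ i.k := Nat.one_le_pow _ _ (Nat.succ_pos ℓ)
  have hn' : (0 : ℝ) < (((ℓ + 1) ^ i.k : ℕ) : ℝ) := by exact_mod_cast hn
  have hmp : 0 ≤ m2plus + a := by linarith [i.hm, i.hm']
  have hCb : Cb a m2plus ≤ max 1 (Cb a m2plus) := le_max_right _ _
  have hT0 : ∀ y' y, |(boxOpR ((ℓ + 1) ^ i.k) a i.m2 i.M)⁻¹ y' y| ≤ max 1 (Cb a m2plus) / (((ℓ + 1) ^ i.k : ℕ) : ℝ) :=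
    fun y' y => (entry_le hn ha i.hm i.hM y' y).trans
      (div_le_div_of_nonneg_right ((cStar_le_Cb ha hmp).trans hCb) hn'.le)
  have hT1 : ∀ y' y, |(((ℓ + 1) ^ i.k : ℕ) : ℝ) *
      ((boxOpR ((ℓ + 1) ^ i.k) a i.m2 i.M)⁻¹ (fwd (fun j => (ℓ + 1) ^ i.k * i.M j) μ y') y
        - (boxOpR ((ℓ + 1) ^ i.k) a i.m2 i.M)⁻¹ y' y)| ≤ max 1 (Cb a m2plus) / (((ℓ + 1) ^ i.k : ℕ) : ℝ) := by
    intro y' y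
    have h := bond_le hn ha i.hm i.hm' i.hM y (y'.1 0)
    rw [← fwd_sub_eq_bond (fun z => (boxOpR ((ℓ + 1) ^ i.k) a i.m2 i.M)⁻¹ z y) μ y'] at h
    rw [abs_mul, abs_of_nonneg hn'.le]
    calc (((ℓ + 1) ^ i.k : ℕ) : ℝ) *
          |(boxOpR ((ℓ + 1) ^ i.k) a i.m2 i.M)⁻¹ (fwd (fun j => (ℓ + 1) ^ i.k * i.M j) μ y') y
            - (boxOpR ((ℓ + 1) ^ i.k) a i.m2 i.M)⁻¹ y' y|
        ≤ (((ℓ + 1) ^ i.k : ℕ) : ℝ) * (Cb a m2plus / (((ℓ + 1) ^ i.k : ℕ) : ℝ) ^ 2) :=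
          mul_le_mul_of_nonneg_left h hn'.le
      _ = Cb a m2plus / (((ℓ + 1) ^ i.k : ℕ) : ℝ) := by
          rw [sq, mul_div_assoc', mul_div_mul_left _ _ hn'.ne']
      _ ≤ max 1 (Cb a m2plus) / (((ℓ + 1) ^ i.k : ℕ) : ℝ) := div_le_div_of_nonneg_right hCb hn'.le
  have hsymm : ((boxOpR ((ℓ + 1) ^ i.k) a i.m2 i.M)⁻¹).IsSymm := boxOpR_inv_isSymm ((ℓ + 1) ^ i.k) a i.m2 i.M
  unfold kerY
  split_ifs with h0 h1
  · exact hT0 x' x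
  · exact hT1 x' x
  · dsimp only
    rw [hsymm.apply (fwd _ μ x) x', hsymm.apply x x']
    exact hT1 x x'

/-- the interpolated constant is dominated uniformly in the exponent: `P^e·A^{1−e} ≤ max(1, P)·max(1, A)` for
`P, A ≥ 0`, `0 ≤ e ≤ 1`. [folklore] -/
theorem rpow_mul_rpow_le_max {P A e : ℝ} (hP : 0 ≤ P) (hA : 0 ≤ A) (he0 : 0 ≤ e) (he1 : e ≤ 1) :
    P ^ e * A ^ (1 - e) ≤ max 1 P * max 1 A := by
  have key : ∀ {X r : ℝ}, 0 ≤ X → 0 ≤ r → r ≤ 1 → X ^ r ≤ max 1 X := by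
    intro X r hX hr0 hr1
    rcases le_or_gt X 1 with h | h
    · exact (Real.rpow_le_one hX h hr0).trans (le_max_left _ _)
    · exact (Real.rpow_le_rpow_of_exponent_le h.le hr1).trans (by rw [Real.rpow_one]; exact le_max_right _ _)
  exact mul_le_mul (key hP he0 he1) (key hA (by linarith) (by linarith)) (Real.rpow_nonneg hA _)
    (le_trans zero_le_one (le_max_left _ _))

/-- **THE QUANTITATIVE CORE OF (2.17) IN ONE DIMENSION, ALL EXPONENTS**: on the zero-field cubes over `ℤ¹` (mesh
`η = (ℓ+1)^{-k}`, `□ = [0, Mη^{-1})`, operator (1.6) with `a > 0`, `0 ≤ m² ≤ m₊²`), ONE constant `c₂` with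
`‖Y f‖_q ≤ c₂‖f‖_p` for all three operators `Y` of (2.17) and ALL `0 ≤ 1/q ≤ 1/p ≤ 1` — no restriction
`1/p − 1/q ≤ 1/p₁` at all (in particular `L¹ → L^∞` for the derivative kernels too). For `1/p − 1/q < 1`:
weighted Young (node 19) from the entry bound `P/n` and the row/column bound `A` (node 15), constant
`P^{1/p−1/q}A^{1−(1/p−1/q)} ≤ max(1,P)·max(1,A)`; for `(p, q) = (1, ∞)`: the entry bound directly.
[cite: Balaban1983RegularityDecay, Lemma 2.2 (2.17) p. 578, case Ã = 0, □ a box, lattice ηℤ¹ (all 1 ≤ p ≤ q ≤ ∞)] -/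
theorem lemma22_17_zero_box_dimOne (hℓ : 1 ≤ ℓ) (a : ℝ) (ha : 0 < a) :
    ∃ c₂ : ℝ, 0 < c₂ ∧ ∀ (i : BoxInst 0 ℓ m2plus) (s t : ℝ) (m : Fin 3) (μ : Fin (0 + 1))
      (f : ↥(toZFC i).R → ℝ), 0 ≤ t → s ≤ 1 → t ≤ s →
        (toZFC i).lpN t ((toZFC i).opY a m μ f) ≤ c₂ * (toZFC i).lpN s f := by
  obtain ⟨A, hA, hsums⟩ := kerY_sums (d := 0) (m2plus := m2plus) hℓ a ha
  obtain ⟨P, hP, hent⟩ := kerY_entry_le (ℓ := ℓ) (m2plus := m2plus) a ha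
  refine ⟨max 1 P * max 1 A, by positivity, fun i s t m μ f ht hs1 hts => ?_⟩
  have hn : 1 ≤ (toZFC i).n := by rw [toZFC_n]; exact Nat.one_le_pow _ _ (Nat.succ_pos ℓ)
  have hn' : (0 : ℝ) < (toZFC i).n := by exact_mod_cast hn
  have hg : ∀ x', (toZFC i).opY a m μ f x' = ∑ x, kerY a i m μ x' x * f x := opY_apply a i m μ f
  have hTe : ∀ x' x, |kerY a i m μ x' x| ≤ P / (toZFC i).n := fun x' x => hent i m μ x' x
  obtain ⟨hrow, hcol⟩ := hsums i m μ
  by_cases hst : s - t < 1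
  · have h := lpN_young (toZFC i) (kerY a i m μ) f ((toZFC i).opY a m μ f) hg
      (div_nonneg hP.le hn'.le) hA.le hTe hrow hcol ht hts hs1 hst
    refine lpN_bound_mono (toZFC i) h ?_
    have e : ((toZFC i).n : ℝ) ^ (0 + 1) * (P / (toZFC i).n) = P := by
      rw [pow_succ, pow_zero, one_mul]; field_simp
    rw [e]
    exact rpow_mul_rpow_le_max hP.le hA.le (by linarith) hst.le
  · have hs : s = 1 := by linarith
    have ht0 : t = 0 := by linarith
    subst hs; subst ht0
    have hB : 0 ≤ P * (toZFC i).lpN 1 f := mul_nonneg hP.le (lpN_nonneg (toZFC i) 1 f)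
    have h0 : (toZFC i).lpN 0 ((toZFC i).opY a m μ f) = (toZFC i).supN ((toZFC i).opY a m μ f) := by
      unfold ZeroFieldCube.lpN
      rw [if_pos rfl]
    have hTe' : ∀ x' x : ↥(toZFC i).R, |kerY a i m μ x' x| * |f x| ≤ P / (toZFC i).n * |f x| :=
      fun x' x => mul_le_mul_of_nonneg_right (hTe x' x) (abs_nonneg _)
    have hsup : (toZFC i).lpN 0 ((toZFC i).opY a m μ f) ≤ P * (toZFC i).lpN 1 f := by
      rw [h0]
      refine supN_le_of_forall (toZFC i) _ hB fun x' => ?_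
      rw [hg x', lpN_one, Finset.mul_sum, Finset.mul_sum]
      calc |∑ x, kerY a i m μ x' x * f x| ≤ ∑ x, |kerY a i m μ x' x * f x| := Finset.abs_sum_le_sum_abs _ _
        _ ≤ ∑ x, P * (((1 : ℝ) / (toZFC i).n) ^ (0 + 1) * |f x|) := Finset.sum_le_sum fun x _ => by
            rw [abs_mul, pow_succ, pow_zero, one_mul, ← mul_assoc, mul_one_div]
            exact hTe' x' x
    refine lpN_bound_mono (toZFC i) hsup ?_
    calc P ≤ max 1 P := le_max_right _ _
      _ = max 1 P * 1 := (mul_one _).symm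
      _ ≤ max 1 P * max 1 A :=
          mul_le_mul_of_nonneg_left (le_max_left _ _) (le_trans zero_le_one (le_max_left _ _))

end Kernels

/-! ## §6 The typed leaf on the one-dimensional cube family for EVERY threshold, and the global dichotomy -/

section Leaf

variable {ℓ : ℕ} {m2plus : ℝ}

/-- **LEMMA 2.2 (2.17) ON THE ONE-DIMENSIONAL ZERO-FIELD CUBE FAMILY, EVERY THRESHOLD `d′`**: the typed leaf
`B4.Lemma22Printed (cubeFam ℓ m₊² a M_b K) d′` over `ℤ¹` (`d = 0`) holds for every `d′ : ℕ` — including the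
printed threshold `d′ = d = 0` («p₁ > d»), where for `d ≥ 1` it FAILS (node 20).
[cite: Balaban1983RegularityDecay, Lemma 2.2 (2.16)–(2.17) pp. 577–578, case Ã = 0, □ a box, lattice ηℤ¹] -/
theorem lemma22Printed_cubeFam_dimOne (hℓ : 1 ≤ ℓ) (a : ℝ) (ha : 0 < a) (Mb K : ℕ) (d' : ℕ) :
    Lemma22Printed (cubeFam (d := 0) ℓ m2plus a Mb K) d' := by
  refine (lemma22Printed_iff _ _).2 ⟨lemma22Printed16_cubeFam hℓ a ha Mb K, fun p₁ _ => ?_⟩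
  obtain ⟨c₂, hc₂, h⟩ := lemma22_17_zero_box_dimOne (m2plus := m2plus) hℓ a ha
  exact ⟨c₂, 1, hc₂, one_pos, fun i _ _ _ _ _ _ s t n μ f ht hs1 _ hts => h i s t n μ f ht hs1 hts⟩

/-- **THE GLOBAL DICHOTOMY OF THE TYPED LEAF ON THE ZERO-FIELD CUBE FAMILIES**: for every lattice dimension
`d + 1 ≥ 1` and every threshold `d′`, `B4.Lemma22Printed (cubeFam ℓ m₊² a M_b K) d′ ↔ (d = 0 ∨ d + 1 ≤ d′)`
(`ℓ, M_b, K ≥ 1`, `a > 0`, `m₊² ≥ 0`): over `ℤ¹` at every threshold (this file), over `ℤ^{d+1}`, `d ≥ 1`, exactly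
at the thresholds `d′ ≥ d + 1` (nodes 19/20).
[cite: Balaban1983RegularityDecay, Lemma 2.2 (2.16)–(2.17) pp. 577–578 with «p₁ > d», case Ã = 0, □ a box] -/
theorem lemma22Printed_cubeFam_iff_all (d : ℕ) (hℓ : 1 ≤ ℓ) {a : ℝ} (ha : 0 < a) (hm2 : 0 ≤ m2plus)
    {Mb K : ℕ} (hMb : 1 ≤ Mb) (hK : 1 ≤ K) (d' : ℕ) :
    Lemma22Printed (cubeFam (d := d) ℓ m2plus a Mb K) d' ↔ (d = 0 ∨ d + 1 ≤ d') := by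
  rcases Nat.eq_zero_or_pos d with rfl | hd
  · simp only [true_or, iff_true]
    exact lemma22Printed_cubeFam_dimOne hℓ a ha Mb K d'
  · rw [lemma22Printed_cubeFam_iff hd hℓ ha hm2 hMb hK d']
    omega

end Leaf

/-! ## §7 Examples -/

section Examples

/-- the typed leaf over `ℤ¹` at the printed threshold `d′ = d = 0` (`ℓ = 1`, `a = m₊² = 1`, `M_b = 5`, `K = 1`). -/
example : Lemma22Printed (cubeFam (d := 0) (m2plus := 1) 1 1 5 1) 0 :=
  lemma22Printed_cubeFam_dimOne le_rfl 1 one_pos 5 1 0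

/-- … and at every threshold. -/
example (d' : ℕ) : Lemma22Printed (cubeFam (d := 0) (m2plus := 1) 1 1 5 1) d' :=
  lemma22Printed_cubeFam_dimOne le_rfl 1 one_pos 5 1 d'

/-- contrast (node 20): over `ℤ²` the same leaf fails at the thresholds `d′ ≤ d = 1`. -/
example : ¬ Lemma22Printed (cubeFam (d := 1) (m2plus := 1) 1 1 5 1) 1 :=
  not_lemma22Printed_cubeFam le_rfl le_rfl one_pos zero_le_one (by norm_num) le_rfl le_rfl

/-- the global dichotomy, instantiated: over `ℤ^{d+1}` the leaf at threshold `d′` iff `d = 0 ∨ d + 1 ≤ d′`. -/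
example (d d' : ℕ) : Lemma22Printed (cubeFam (d := d) (m2plus := 1) 1 1 5 1) d' ↔ (d = 0 ∨ d + 1 ≤ d') :=
  lemma22Printed_cubeFam_iff_all d le_rfl one_pos zero_le_one (by norm_num) le_rfl d'

/-- the one-dimensional `L¹ → L^∞` bound for all three operators of (2.17): the corner `(1/p, 1/q) = (1, 0)`, outside
the printed range for every «p₁ > d» (`1/p − 1/q = 1 > 1/p₁`), and FALSE at zero field over `ℤ^{d+1}`, `d ≥ 1`
(node 20). -/
example : ∃ c₂ : ℝ, 0 < c₂ ∧ ∀ (i : BoxInst 0 1 (1 : ℝ)) (m : Fin 3) (μ : Fin (0 + 1)) (f : ↥(toZFC i).R → ℝ),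
    (toZFC i).lpN 0 ((toZFC i).opY 1 m μ f) ≤ c₂ * (toZFC i).lpN 1 f := by
  obtain ⟨c₂, hc₂, h⟩ := lemma22_17_zero_box_dimOne (ℓ := 1) (m2plus := 1) le_rfl 1 one_pos
  exact ⟨c₂, hc₂, fun i m μ f => h i 1 0 m μ f le_rfl le_rfl zero_le_one⟩

/-- the pointwise energy bound, instantiated (`n = 3`, `a = 1`, `m² = 0`, box `[0, 3M)`). -/
example (M : Fin (0 + 1) → ℕ) (v : ↥(boxDom fun i => 3 * M i) → ℝ) (X : ↥(boxDom fun i => 3 * M i)) :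
    v X ^ 2 ≤ cStar 1 / (3 : ℕ) * (v ⬝ᵥ (boxOpR 3 1 0 M) *ᵥ v) :=
  sq_le_energy (by norm_num) one_pos le_rfl v X

/-- non-vacuity: the one-dimensional family has members at every level `k ≥ 1` meeting all antecedents. -/
example (k : ℕ) (hk : 1 ≤ k) : ∃ i : BoxInst 0 1 (1 : ℝ), i.k = k ∧ (cubeFam 1 (1 : ℝ) 1 5 1 i).rect ∧
    (cubeFam 1 (1 : ℝ) 1 5 1 i).fewLargeBlocks ∧ (cubeFam 1 (1 : ℝ) 1 5 1 i).regular ∧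
    (cubeFam 1 (1 : ℝ) 1 5 1 i).constNearBdry ∧ 0 < (cubeFam 1 (1 : ℝ) 1 5 1 i).e ∧
    (cubeFam 1 (1 : ℝ) 1 5 1 i).e ≤ 1 :=
  threshold_metC zero_le_one 1 (by norm_num) le_rfl k hk one_pos

end Examples

end

end Literature.MathematicalPhysics.QuantumFieldTheory.Balaban1983to89.B4Lemma22ZeroBoxDimOne
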